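import Literature.Topology.Immersions.ProjBundleOrientation
import Mathlib.Geometry.Manifold.VectorBundle.Basic
import HarnessLib

/-!
# The vector bundle core of a projection-field bundle

Topic `Literature/Topology/Immersions`. Bridge from the tree's elementary projection-field
bundles `E = E(P)` in `M × ℝᵐ` (`ProjectionFieldBundle.lean`) to Mathlib's vector bundles:
the bundle charts of `P` (base points `x₀ : M`, good sets `U_{x₀}`, transported frames
`A⁰_x = P_x ∘ B_{x₀}`) define a `VectorBundleCore ℝ M ℝᵏ M` whose coordinate changes are the
frame transitions `g_{x₀x₁}(x) = leftInv(A¹_x) ∘ A⁰_x` (Milnor–Stasheff, *Characteristic Classes*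
(1974), §2 pp. 14–16: local trivialisations and the cocycle of transition functions; the cocycle
identity holds because `A¹ ∘ leftInv(A¹)` is the identity on `E_x = range A¹`). The coordinate
changes are `C^∞`, so the core is a `C^∞` vector bundle core.

* `ProjBundle.core P : VectorBundleCore ℝ M (EuclideanSpace ℝ (Fin k)) M`, `core_coordChange`,
  `core_baseSet`;
* `ProjBundle.core_isContMDiff : (P.core).IsContMDiff (𝓡 n) ∞`;
* `ProjBundle.coreFibreEquiv P x : ℝᵏ ≃ₗ[ℝ] E_x` — the identification of the abstract fibre of
  the core at `x` (index `x`) with the concrete fibre `E_x ⊆ ℝᵐ`, `v ↦ B_x v`.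

Everything here is proved; the definitions are data; no named facts.

## References

* J. Milnor, J. Stasheff, *Characteristic Classes* (1974), §2 pp. 14–16. [MilnorStasheff1974]
-/

open scoped Manifold ContDiff Topology
open Set Function Module

noncomputable section

namespace Literature.Topology.Immersions

/-- Local notation: `𝔼 n` is the model Euclidean space `EuclideanSpace ℝ (Fin n)`. -/
local notation "𝔼 " n:arg => EuclideanSpace ℝ (Fin n)

open Literature.Topology.FourManifolds (leftInv leftInv_apply_self apply_leftInv_of_mem_range
  contDiffAt_leftInv)

namespace ProjBundle

variable {n m k : ℕ} {M : Type*} [TopologicalSpace M] [ChartedSpace (𝔼 n) M]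
  (P : ProjBundle n m k M)

/-- **The vector bundle core of `E(P)`**: charts indexed by base points, base sets the good sets,
coordinate changes the frame transitions. [cite: MilnorStasheff1974, §2 pp. 14–16] -/
def core : VectorBundleCore ℝ M (𝔼 k) M where
  baseSet x₀ := P.goodSet x₀
  isOpen_baseSet x₀ := P.isOpen_goodSet x₀
  indexAt x := x
  mem_baseSet_at x := P.mem_goodSet_self x
  coordChange x₀ x₁ x := frameTransition (P.frameAt x₁ x) (P.frameAt x₀ x)
  coordChange_self x₀ x hx v := leftInv_apply_self hx.2 v
  continuousOn_coordChange x₀ x₁ := by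
    have h1 : ContinuousOn (fun x => leftInv (P.frameAt x₁ x)) (P.goodSet x₀ ∩ P.goodSet x₁) :=
      fun x hx => ((contDiffAt_leftInv hx.2.2).continuousAt.comp_continuousWithinAt
        (P.continuous_frameAt x₁).continuousWithinAt)
    exact h1.clm_comp (P.continuous_frameAt x₀).continuousOn
  coordChange_comp x₀ x₁ x₂ x hx v := by
    show leftInv (P.frameAt x₂ x) (P.frameAt x₁ x (leftInv (P.frameAt x₁ x) (P.frameAt x₀ x v))) =
      leftInv (P.frameAt x₂ x) (P.frameAt x₀ x v)
    have hmem : P.frameAt x₀ x v ∈ LinearMap.range (P.frameAt x₁ x).toLinearMap := by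
      rw [P.range_frameAt_of_mem hx.1.2]
      exact P.frameAt_apply_mem x₀ x v
    rw [apply_leftInv_of_mem_range hx.1.2.2 hmem]

/-- The base sets of the core are the good sets. [folklore] -/
@[simp] theorem core_baseSet (x₀ : M) : P.core.baseSet x₀ = P.goodSet x₀ := rfl

/-- The index of the preferred chart at `x` is `x`. [folklore] -/
@[simp] theorem core_indexAt (x : M) : P.core.indexAt x = x := rfl

/-- The coordinate changes of the core are the frame transitions. [folklore] -/
theorem core_coordChange (x₀ x₁ x : M) (v : 𝔼 k) :
    P.core.coordChange x₀ x₁ x v = leftInv (P.frameAt x₁ x) (P.frameAt x₀ x v) := rfl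

/-- **The core is a `C^∞` vector bundle core.** [cite: MilnorStasheff1974, §2 pp. 14–16] -/
theorem core_isContMDiff [IsManifold (𝓡 n) ∞ M] : P.core.IsContMDiff (𝓡 n) ∞ := by
  refine ⟨fun x₀ x₁ => ?_⟩
  have h1 : ContMDiffOn (𝓡 n) 𝓘(ℝ, 𝔼 m →L[ℝ] 𝔼 k) ∞ (fun x => leftInv (P.frameAt x₁ x))
      (P.goodSet x₀ ∩ P.goodSet x₁) := fun x hx =>
    (ContDiffAt.comp_contMDiffAt (f := P.frameAt x₁) (x := x) (contDiffAt_leftInv hx.2.2)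
      (P.contMDiff_frameAt x₁ x)).contMDiffWithinAt
  exact h1.clm_comp (P.contMDiff_frameAt x₀).contMDiffOn

/-- **The abstract fibre of the core at `x` is the concrete fibre `E_x`**: `v ↦ B_x v`
(`B_x = fibreParam x = frameAt x x`). [folklore] -/
def coreFibreEquiv (x : M) : 𝔼 k ≃ₗ[ℝ] P.fibre x :=
  LinearEquiv.ofBijective
    (LinearMap.codRestrict (P.fibre x) (P.frameAt x x).toLinearMap fun v => P.frameAt_apply_mem x x v)
    ⟨fun v w h => (P.mem_goodSet_self x).2 (congrArg Subtype.val h),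
     fun ⟨w, hw⟩ => by
        rw [← P.range_frameAt_of_mem (P.mem_goodSet_self x)] at hw
        obtain ⟨v, rfl⟩ := hw
        exact ⟨v, rfl⟩⟩

/-- The fibre identification, as a vector of `ℝᵐ`. [folklore] -/
@[simp] theorem coreFibreEquiv_apply (x : M) (v : 𝔼 k) :
    (P.coreFibreEquiv x v : 𝔼 m) = P.frameAt x x v := rfl

end ProjBundle

end Literature.Topology.Immersions
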